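import Summits.QuantumAdvantage.QuantumAdvantage.Theorems.CubicForrelationNearExactIsExactTwelveZ768OffDiv4

/-!
# Crux `CubicForrelation.NearExactIsExact` (stmt-QuantumAdvantage-14043) — n = 12, configuration `#Z = 768` at level `≥ 6`:
  off-`Z` energy `≤ 127` already forces `4 ∣ e` off `Z` (a 10-flat avoiding `Z`)

Certificate seat `b2b-cforr-cert` (gen 26).  HONEST FRAMING: a finite-slice structure lemma (standard axioms) about cubic Boolean functions on
12 bits; it claims NO value of `θ₁₂`.  NOT summit progress.  It sharpens `tzo_off_div4` (…TwelveZ768OffDiv4, threshold `63`, a 9-flat) to the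
threshold `127` — which covers the WHOLE open window `57/64 < Φ < 29/32` (there `Σ e² < 896`, so the off-`Z` energy is `≤ 896 − 768 − 1`).

Setting: `W_g = 64u''` (`g` cubic), `Z = {u'' even}` with `#Z = 768` (`Z` is stable under the period group `P`, `#P = 128`, gen 25's `tbc_*`),
`f` cubic, `e = u'' − (−1)^f` (even off `Z`).

THEOREM `tzo_off_div4_le127`: if `Σ_{x ∉ Z} e(x)² ≤ 127` then `4 ∣ e` off `Z`.
Proof.  Let `y₀ ∉ Z` with `e(y₀) ≡ 2 (mod 4)`.  Three directions `d₁, d₂, d₃` are chosen by counting so that `V₁₀ := P ⊕ ⟨d₁, d₂, d₃⟩` has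
`2¹⁰` elements and the 10-flat `F := y₀ ⊕ V₁₀` misses `Z`: the `k`-th direction must avoid the current span (`128·2^{k−1}` points) and the
`2^{k−1}` translates `(y₀ ⊕ r) ⊕ Z` over the coset representatives `r` already present (`768` points each); for `k = 3` this forbids at most
`512 + 4·768 = 3584 < 4096` points.  On `F` the residual is even with 6-flat sums `≡ 0 (mod 4)` (`gh_flat_dvd`), so one round of wild-point
parity (`ws_erm_round`, Reed–Muller distance `2^{10−5} = 32` on the abstract 10-flat) gives `≥ 32` points of `F` with `e/2` odd, each costing
`e² ≥ 4`: off-`Z` energy `≥ 128`.  Contradiction.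

Use (…TwelveZ768WindowDead): together with `tzd_Z768_div4_false` this kills the configuration `#Z = 768` on the whole open window.

References: MacWilliams–Sloane (1977) Ch. 13 §3 (Reed–Muller codes on a flat), Ch. 15; R. O'Donnell (2014) §3.3.  Axioms: the standard three.
-/

set_option linter.dupNamespace false -- D-0017: single-problem summit ⇒ `QuantumAdvantage.QuantumAdvantage` by design

noncomputable section

namespace Summit.QuantumAdvantage.QuantumAdvantage.Theorems.CubicForrelation.NearExactIsExact

open Finset
open Literature.Computability.QuantumComplexity
open Literature.Computability.QuantumComplexity.BuzetChailloux (bxor zeroVec bxor_bxor_cancel_left bxor_zeroVec zeroVec_bxor bxor_comm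
  bxor_self)
open Literature.Computability.QuantumComplexity.DerivativeWalsh (W)

/-- xor bookkeeping: `(y ⊕ d) ⊕ c = (y ⊕ c) ⊕ d`. [folklore] -/
theorem tzo_swap (y d c : Fin (6 + 6) → Bool) : bxor (bxor y d) c = bxor (bxor y c) d := by
  funext k; simp only [bxor]; cases y k <;> cases d k <;> cases c k <;> rfl

/-- **Doubling an avoiding coset.**  If `y ⊕ V` and `(y ⊕ d) ⊕ V` both miss `Z`, so does `y ⊕ (V ∪ (d ⊕ V))`. [folklore] -/
theorem tzo_avoid_double (Z V : Finset (Fin (6 + 6) → Bool)) (y d : Fin (6 + 6) → Bool)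
    (h1 : ∀ v ∈ V, bxor y v ∉ Z) (h2 : ∀ v ∈ V, bxor (bxor y d) v ∉ Z) :
    ∀ v ∈ V ∪ V.image (bxor d), bxor y v ∉ Z := by
  intro v hv
  rcases mem_union.1 hv with hv | hv
  · exact h1 v hv
  · obtain ⟨w, hw, rfl⟩ := mem_image.1 hv
    rw [← iw_bxor_assoc]
    exact h2 w hw

/-- **Off-`Z` energy `≤ 127` forces `4 ∣ e` off `Z`** for a level-`≥ 6` side with `#Z = 768` (module docstring).  Finite-slice statement,
NOT summit progress. [this work] -/
theorem tzo_off_div4_le127 (f g : (Fin (6 + 6) → Bool) → Bool) (hf : IsDegLeFun 3 f) (hg : IsDegLeFun 3 g)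
    (u'' : (Fin (6 + 6) → Bool) → ℤ) (hu'' : ∀ x, W (fun y => signOf (g y)) x = (2 : ℝ) ^ 6 * (u'' x : ℝ))
    (h768 : #(univ.filter fun x : Fin (6 + 6) → Bool => ¬ Odd (u'' x)) = 768)
    (hoff : ∑ x ∈ univ.filter (fun x => x ∉ univ.filter (fun x : Fin (6 + 6) → Bool => ¬ Odd (u'' x))),
      (u'' x - sZ (f x)) ^ 2 ≤ 127) :
    ∀ y, y ∉ (univ.filter fun x : Fin (6 + 6) → Bool => ¬ Odd (u'' x)) → (4 : ℤ) ∣ u'' y - sZ (f y) := by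
  classical
  set Z := univ.filter (fun x : Fin (6 + 6) → Bool => ¬ Odd (u'' x)) with hZdef
  set P := (univ.filter fun a : Fin (6 + 6) → Bool => ∀ x, decide (Odd (u'' (bxor x a))) = decide (Odd (u'' x))) with hPdef
  set e : (Fin (6 + 6) → Bool) → ℤ := fun x => u'' x - sZ (f x) with hedef
  show ∀ y, y ∉ Z → (4 : ℤ) ∣ e y
  by_contra hcon
  push Not at hcon
  obtain ⟨y₀, hy₀, hy₀4⟩ := hcon
  have hP0 : zeroVec ∈ P := tbc_P_zero u''
  have hPadd : ∀ a ∈ P, ∀ b ∈ P, bxor a b ∈ P := tbc_P_add u''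
  have hZst : ∀ x ∈ Z, ∀ a ∈ P, bxor x a ∈ Z := fun x hx a ha => tbc_Z_stable u'' hx ha
  have hP : #P = 128 := tbc_card_P g hg u'' hu'' h768
  have huniv : #(univ : Finset (Fin (6 + 6) → Bool)) = 4096 := by simp
  have hout : ∀ x, x ∉ Z → ∀ p ∈ P, bxor x p ∉ Z := by
    intro x hx p hp h
    apply hx
    have h' := hZst _ h _ hp
    rwa [iw_bxor_assoc, bxor_self, bxor_zeroVec] at h'
  have heven : ∀ x, x ∉ Z → Even (e x) := fun x hx => gh_even_off f u'' x hx
  -- membership in a translate of `Z`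
  have himZ : ∀ c d : Fin (6 + 6) → Bool, d ∉ Z.image (bxor c) → bxor c d ∉ Z :=
    fun c d hd h => hd (mem_image.2 ⟨bxor c d, h, bxor_bxor_cancel_left c d⟩)
  -- the first transversal direction
  obtain ⟨d₁, -, hd₁⟩ : ∃ d₁ ∈ (univ : Finset (Fin (6 + 6) → Bool)), d₁ ∉ P ∪ Z.image (bxor y₀) :=
    exists_mem_notMem_of_card_lt_card (by
      rw [huniv]
      calc #(P ∪ Z.image (bxor y₀)) ≤ #P + #(Z.image (bxor y₀)) := card_union_le _ _
        _ ≤ 128 + 768 := Nat.add_le_add hP.le (card_image_le.trans h768.le)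
        _ < 4096 := by norm_num)
  rw [mem_union, not_or] at hd₁
  have hy₁ : bxor y₀ d₁ ∉ Z := himZ y₀ d₁ hd₁.2
  set V₈ := P ∪ P.image (bxor d₁) with hV₈
  obtain ⟨h80, h8add, h8sub, h8d, -⟩ := fo_double_closed P hP0 hPadd d₁
  have h8card : #V₈ = 256 := by rw [hV₈, tzo_double_card P hPadd d₁ hd₁.1, hP]
  -- the second transversal direction
  obtain ⟨d₂, -, hd₂⟩ : ∃ d₂ ∈ (univ : Finset (Fin (6 + 6) → Bool)),
      d₂ ∉ V₈ ∪ Z.image (bxor y₀) ∪ Z.image (bxor (bxor y₀ d₁)) :=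
    exists_mem_notMem_of_card_lt_card (by
      rw [huniv]
      calc #(V₈ ∪ Z.image (bxor y₀) ∪ Z.image (bxor (bxor y₀ d₁)))
          ≤ #(V₈ ∪ Z.image (bxor y₀)) + #(Z.image (bxor (bxor y₀ d₁))) := card_union_le _ _
        _ ≤ (#V₈ + #(Z.image (bxor y₀))) + #(Z.image (bxor (bxor y₀ d₁))) := Nat.add_le_add_right (card_union_le _ _) _
        _ ≤ (256 + 768) + 768 :=
          Nat.add_le_add (Nat.add_le_add h8card.le (card_image_le.trans h768.le)) (card_image_le.trans h768.le)
        _ < 4096 := by norm_num)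
  rw [mem_union, mem_union, not_or, not_or] at hd₂
  have hy₂ : bxor y₀ d₂ ∉ Z := himZ y₀ d₂ hd₂.1.2
  have hy₁₂ : bxor (bxor y₀ d₁) d₂ ∉ Z := himZ (bxor y₀ d₁) d₂ hd₂.2
  set V₉ := V₈ ∪ V₈.image (bxor d₂) with hV₉
  obtain ⟨h90, h9add, h9sub, h9d, -⟩ := fo_double_closed V₈ h80 h8add d₂
  have h9card : #V₉ = 512 := by rw [hV₉, tzo_double_card V₈ h8add d₂ hd₂.1.1, h8card]
  -- avoiding: `y₀ ⊕ V₈`, `(y₀ ⊕ d₂) ⊕ V₈`, hence `y₀ ⊕ V₉`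
  have hA_P : ∀ y, y ∉ Z → ∀ v ∈ P, bxor y v ∉ Z := fun y hy v hv => hout y hy v hv
  have hA_8 : ∀ y, y ∉ Z → bxor y d₁ ∉ Z → ∀ v ∈ V₈, bxor y v ∉ Z :=
    fun y hy hy1 => tzo_avoid_double Z P y d₁ (hA_P y hy) (hA_P _ hy1)
  have hA_9 : ∀ y, y ∉ Z → bxor y d₁ ∉ Z → bxor y d₂ ∉ Z → bxor (bxor y d₂) d₁ ∉ Z → ∀ v ∈ V₉, bxor y v ∉ Z :=
    fun y hy hy1 hy2 hy21 => tzo_avoid_double Z V₈ y d₂ (hA_8 y hy hy1) (hA_8 _ hy2 hy21)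
  have hy₂₁ : bxor (bxor y₀ d₂) d₁ ∉ Z := by rw [tzo_swap]; exact hy₁₂
  have hV9avoid : ∀ v ∈ V₉, bxor y₀ v ∉ Z := hA_9 y₀ hy₀ hy₁ hy₂ hy₂₁
  -- the third transversal direction
  obtain ⟨d₃, -, hd₃⟩ : ∃ d₃ ∈ (univ : Finset (Fin (6 + 6) → Bool)),
      d₃ ∉ V₉ ∪ Z.image (bxor y₀) ∪ Z.image (bxor (bxor y₀ d₁)) ∪ Z.image (bxor (bxor y₀ d₂)) ∪
        Z.image (bxor (bxor (bxor y₀ d₂) d₁)) :=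
    exists_mem_notMem_of_card_lt_card (by
      rw [huniv]
      have hZi : ∀ c : Fin (6 + 6) → Bool, #(Z.image (bxor c)) ≤ 768 := fun c => card_image_le.trans h768.le
      calc #(V₉ ∪ Z.image (bxor y₀) ∪ Z.image (bxor (bxor y₀ d₁)) ∪ Z.image (bxor (bxor y₀ d₂)) ∪
              Z.image (bxor (bxor (bxor y₀ d₂) d₁)))
          ≤ #(V₉ ∪ Z.image (bxor y₀) ∪ Z.image (bxor (bxor y₀ d₁)) ∪ Z.image (bxor (bxor y₀ d₂))) +
              #(Z.image (bxor (bxor (bxor y₀ d₂) d₁))) := card_union_le _ _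
        _ ≤ (#(V₉ ∪ Z.image (bxor y₀) ∪ Z.image (bxor (bxor y₀ d₁))) + #(Z.image (bxor (bxor y₀ d₂)))) + 768 :=
              Nat.add_le_add (card_union_le _ _) (hZi _)
        _ ≤ ((#(V₉ ∪ Z.image (bxor y₀)) + #(Z.image (bxor (bxor y₀ d₁)))) + 768) + 768 :=
              Nat.add_le_add_right (Nat.add_le_add (card_union_le _ _) (hZi _)) _
        _ ≤ (((#V₉ + #(Z.image (bxor y₀))) + 768) + 768) + 768 :=
              Nat.add_le_add_right (Nat.add_le_add_right (Nat.add_le_add (card_union_le _ _) (hZi _)) _) _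
        _ ≤ (((512 + 768) + 768) + 768) + 768 :=
              Nat.add_le_add_right (Nat.add_le_add_right (Nat.add_le_add_right (Nat.add_le_add h9card.le (hZi _)) _) _) _
        _ < 4096 := by norm_num)
  simp only [mem_union, not_or] at hd₃
  obtain ⟨⟨⟨⟨hd₃V, hd₃0⟩, hd₃1⟩, hd₃2⟩, hd₃21⟩ := hd₃
  have hy₃ : bxor y₀ d₃ ∉ Z := himZ y₀ d₃ hd₃0
  have hy₃₁ : bxor (bxor y₀ d₃) d₁ ∉ Z := by rw [tzo_swap]; exact himZ _ d₃ hd₃1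
  have hy₃₂ : bxor (bxor y₀ d₃) d₂ ∉ Z := by rw [tzo_swap]; exact himZ _ d₃ hd₃2
  have hy₃₂₁ : bxor (bxor (bxor y₀ d₃) d₂) d₁ ∉ Z := by
    rw [tzo_swap (bxor y₀ d₃) d₂ d₁, tzo_swap y₀ d₃ d₁, ← tzo_swap (bxor y₀ d₁) d₂ d₃, ← tzo_swap y₀ d₂ d₁]
    exact himZ _ d₃ hd₃21
  set V₁₀ := V₉ ∪ V₉.image (bxor d₃) with hV₁₀
  obtain ⟨h100, h10add, h10sub, h10d, -⟩ := fo_double_closed V₉ h90 h9add d₃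
  have h10card : #V₁₀ = 2 ^ 10 := by rw [hV₁₀, tzo_double_card V₉ h9add d₃ hd₃V, h9card]; norm_num
  -- the 10-flat `F = y₀ ⊕ V₁₀` misses `Z`
  set F := V₁₀.image (bxor y₀) with hF
  have hV10avoid : ∀ v ∈ V₁₀, bxor y₀ v ∉ Z :=
    tzo_avoid_double Z V₉ y₀ d₃ hV9avoid (hA_9 _ hy₃ hy₃₁ hy₃₂ hy₃₂₁)
  have hFZ : ∀ x ∈ F, x ∉ Z := by
    intro x hx
    obtain ⟨v, hv, rfl⟩ := mem_image.1 hx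
    exact hV10avoid v hv
  have hFst : ∀ x, x ∈ F → ∀ a ∈ V₁₀, bxor x a ∈ F := fun x hx a ha => fl1_coset_vadd h10add rfl hx ha
  have hy₀F : y₀ ∈ F := mem_image.2 ⟨zeroVec, h100, bxor_zeroVec y₀⟩
  -- 6-flat sums of the residual are `≡ 0 (mod 4)`
  have hflat6 : ∀ (b : Fin (6 + 6) → Bool) (a : Fin 6 → Fin (6 + 6) → Bool),
      (4 : ℤ) ∣ ∑ ε : Fin 6 → Bool, e (fun j => b j ^^ decide (Odd #(univ.filter fun i => ε i && a i j))) := by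
    intro b a
    have h := gh_flat_dvd (e := 2) f g hf hg u'' hu'' b a (by norm_num) (by norm_num)
    rwa [show ((2 : ℤ) ^ 2) = 4 by norm_num] at h
  -- one round of wild-point parity on `F`
  have hp2 : ∀ y, y ∉ Z → e y = 2 * (e y / 2) := fun y hy =>
    (Int.mul_ediv_cancel' (even_iff_two_dvd.1 (heven y hy))).symm
  rcases ws_erm_round V₁₀ h100 h10add h10card y₀ (fun y => e y / 2) 5 (fun b hb a ha => by
      have hpts : ∀ ε : Fin (5 + 1) → Bool, (fun j => b j ^^ decide (Odd #(univ.filter fun i => ε i && a i j))) ∈ F :=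
        fun ε => ws_flatPt_mem V₁₀ h100 (· ∈ F) hFst (5 + 1) b hb a ha ε
      have h4 := hflat6 b a
      rw [sum_congr rfl fun ε _ => hp2 _ (hFZ _ (hpts ε)), ← mul_sum] at h4
      obtain ⟨k, hk⟩ := h4
      exact ⟨k, by linarith⟩) with hev | hbig
  · have h := hev y₀ hy₀F
    apply hy₀4
    obtain ⟨k, hk⟩ := h
    exact ⟨k, by rw [hp2 y₀ hy₀, hk]; ring⟩
  · have hcount : (4 : ℤ) * #(F.filter fun x => Odd (e x / 2)) ≤ 127 := by
      calc (4 : ℤ) * #(F.filter fun x => Odd (e x / 2)) = ∑ x ∈ F.filter (fun x => Odd (e x / 2)), (4 : ℤ) := by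
            rw [sum_const, nsmul_eq_mul, mul_comm]
        _ ≤ ∑ x ∈ F.filter (fun x => Odd (e x / 2)), e x ^ 2 := by
            refine sum_le_sum fun x hx => ?_
            have hx' := mem_filter.1 hx
            have hxZ : x ∉ Z := hFZ x hx'.1
            have h0' := Int.odd_iff.1 hx'.2
            have h2 := hp2 x hxZ
            have : e x ≤ -2 ∨ 2 ≤ e x := by omega
            have := tp_sq_ge (k := 2) (by norm_num) this
            linarith
        _ ≤ ∑ x ∈ univ.filter (fun x => x ∉ Z), e x ^ 2 :=
            sum_le_sum_of_subset_of_nonneg (fun x hx => mem_filter.2 ⟨mem_univ _, hFZ x (mem_filter.1 hx).1⟩)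
              fun x _ _ => sq_nonneg _
        _ ≤ 127 := hoff
    change 2 ^ 10 ≤ 2 ^ 5 * #(F.filter fun x => Odd (e x / 2)) at hbig
    norm_num at hbig
    have : (32 : ℤ) ≤ #(F.filter fun x => Odd (e x / 2)) := by exact_mod_cast (by omega)
    linarith

end Summit.QuantumAdvantage.QuantumAdvantage.Theorems.CubicForrelation.NearExactIsExact

end
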